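import Mathlib
import Summits.Ventures.HodgeRepro0.P6NonSimple2PowerCompleteLemmas
/-!
# P6NonSimple2PowerCompleteLemmas2 — the assembly with the keys restricted to the tuples that carry a configuration
(p6 g10; item P6-54-COMPLETENESS).  `P6NonSimple2PowerCompleteLemmas`'s `d2` quantifies over EVERY faithful tuple `Hs`,
including tuples one of whose blocks has NO primitive CM type (a `C₂ × C₂` quotient block, where every 2-subset is a coset of
an intermediate subgroup): no configuration exists there, the listed types of the other blocks are empty, and `d2` is false —
while the theorem's hypotheses (`Φ_b ∈ primTypes` for every `b`) are unsatisfiable for such `Hs`.  So `keysP`/`d2b` restrict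
the keys to the tuples all of whose blocks have a primitive type (`d3`–`d6`, `dC` unchanged), and `complete_of2` is
`complete_of` with `d2b` in place of `d2`.  Never frozen.
-/

namespace HodgeRepro0.P6NonSimple2Power

/-- The keys of the tuples all of whose blocks have a primitive CM type. -/
def keysP (L : List Raw) (sizes : List ℕ) : List (List ℕ × ℕ × List (List ℕ)) :=
  (involutions.flatMap (fun iota =>
    ((HtuplesF iota sizes).filter (fun Hs => (List.range Hs.length).all (fun b => !(primTypes (Hs.getD b []) iota).isEmpty))).flatMap
      (fun Hs => (List.range Hs.length).map (fun b => (Hs.getD b [], iota, listedTypes L iota Hs b))))).eraseDups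

/-- (D2b) for every key of `keysP` and every primitive type `Φ` of its block: the shift `findShift` makes it a listed type. -/
def d2b (L : List Raw) (sizes : List ℕ) : Bool :=
  (keysP L sizes).all (fun k => (primTypes k.1 k.2.1).all (fun Phi => k.2.2.contains (shiftT k.1 (findShift k.1 k.2.2 Phi) Phi)))

/-- The key of a block of a configuration of the statement is in `keysP`. -/
theorem mem_keysP (L : List Raw) (sizes : List ℕ) (iota : ℕ) (hι : iota ∈ involutions) (Hs : List (List ℕ))
    (hHs : Hs ∈ HtuplesF iota sizes) (hne : ∀ b, b < Hs.length → (primTypes (Hs.getD b []) iota).isEmpty = false)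
    (b : ℕ) (hb : b < Hs.length) : (Hs.getD b [], iota, listedTypes L iota Hs b) ∈ keysP L sizes := by
  unfold keysP
  rw [List.mem_eraseDups]
  simp only [List.mem_flatMap, List.mem_map, List.mem_range, List.mem_filter]
  refine ⟨iota, hι, Hs, ⟨hHs, ?_⟩, b, hb, rfl⟩
  rw [List.all_eq_true]
  intro b' hb'
  rw [List.mem_range] at hb'
  show (!(primTypes (Hs.getD b' []) iota).isEmpty) = true
  rw [hne b' hb']
  rfl

/-- THE ASSEMBLY (with `d2b`): from the decided facts (D2b), (D3)–(D6) and `Q` on the listed configurations, `Q` on every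
configuration of the statement (the translation reduction lives here, inside the proof). -/
theorem complete_of2 (L : List Raw) (sizes : List ℕ) (hd2 : d2b L sizes = true) (hd3 : d3 L sizes = true) (hd4 : d4 = true)
    (hd5 : d5 L sizes = true) (hd6 : d6 L sizes = true) (hQ : ∀ r ∈ L, Q r) :
    ∀ iota ∈ involutions, ∀ Hs ∈ HtuplesF iota sizes, ∀ Phis : List (List ℕ), Phis.length = Hs.length →
      (∀ b (_ : b < Hs.length), Phis.getD b [] ∈ primTypes (Hs.getD b []) iota) → Q ⟨iota, Hs, Phis⟩ := by
  intro iota hι Hs hHs Phis hlen hprim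
  have hHs' : Hs ∈ Htuples iota sizes := (List.mem_filter.mp hHs).1
  have hsub : ∀ b, b < Hs.length → Hs.getD b [] ∈ subgroups := Htuples_mem_sub iota sizes Hs hHs'
  have hkey : ∀ b, b < Hs.length → (Hs.getD b [], iota, listedTypes L iota Hs b) ∈ keys L sizes :=
    fun b hb => mem_keys L sizes iota hι Hs hHs b hb
  have hne : ∀ b, b < Hs.length → (primTypes (Hs.getD b []) iota).isEmpty = false := by
    intro b hb
    have hmem := hprim b hb
    cases h : (primTypes (Hs.getD b []) iota).isEmpty
    · rfl
    · rw [List.isEmpty_iff] at h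
      rw [h] at hmem
      exact absurd hmem (List.not_mem_nil)
  have hkeyP : ∀ b, b < Hs.length → (Hs.getD b [], iota, listedTypes L iota Hs b) ∈ keysP L sizes :=
    fun b hb => mem_keysP L sizes iota hι Hs hHs hne b hb
  -- the shifts and the listed configuration
  set sb : ℕ → ℕ := fun b => findShift (Hs.getD b []) (listedTypes L iota Hs b) (Phis.getD b []) with hsb
  have hsbmem : ∀ b, sb b ∈ elems := fun b => findD_mem_elems _
  set Phis' : List (List ℕ) := (List.range Hs.length).map (fun b => shiftT (Hs.getD b []) (sb b) (Phis.getD b [])) with hPhis'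
  have hPhis'b : ∀ b, b < Hs.length → Phis'.getD b [] = shiftT (Hs.getD b []) (sb b) (Phis.getD b []) :=
    fun b hb => getD_map_range _ _ _ _ hb
  have hD2 : ∀ b, b < Hs.length → Phis'.getD b [] ∈ listedTypes L iota Hs b := by
    intro b hb
    have h1 := List.all_eq_true.mp hd2 _ (hkeyP b hb)
    have h2 := List.all_eq_true.mp h1 (Phis.getD b []) (hprim b hb)
    rw [hPhis'b b hb]
    exact List.contains_iff_mem.mp h2
  have hmem : (⟨iota, Hs, Phis'⟩ : Raw) ∈ L := by
    have h1 := List.all_eq_true.mp hd3 iota hι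
    have h2 := List.all_eq_true.mp h1 Hs hHs
    have hc : Phis' ∈ combos ((List.range Hs.length).map (fun b => listedTypes L iota Hs b)) := by
      refine mem_combos _ _ (by simp [hPhis']) ?_
      intro b hb
      have hb' : b < Hs.length := by simpa using hb
      rw [getD_map_range _ _ _ _ hb']
      exact hD2 b hb'
    have h3 := List.all_eq_true.mp h2 Phis' hc
    obtain ⟨r, hr, hreq⟩ := List.any_eq_true.mp h3
    rw [eq_of_rawEq _ _ hreq]
    exact hr
  have hQ' : Q ⟨iota, Hs, Phis'⟩ := hQ _ hmem
  have hback : ∀ b, b < Hs.length → Phis.getD b [] = shiftT (Hs.getD b []) (tneg (sb b)) (Phis'.getD b []) := by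
    intro b hb
    have hhi : (Hs.getD b [], iota) ∈ hiPairs L sizes := by
      unfold hiPairs
      rw [List.mem_eraseDups, List.mem_map]
      exact ⟨_, hkey b hb, rfl⟩
    have h1 := List.all_eq_true.mp hd6 _ hhi
    have h2 := List.all_eq_true.mp h1 (Phis.getD b []) (hprim b hb)
    have h3 := List.all_eq_true.mp h2 (sb b) (hsbmem b)
    rw [hPhis'b b hb]
    exact (beq_iff_eq.mp h3).symm
  have hD4 : ∀ b, b < Hs.length → ∀ x ∈ names (Hs.getD b []),
      rep (Hs.getD b []) (tadd (sb b) x) ∈ names (Hs.getD b []) ∧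
      rep (Hs.getD b []) (tadd (tneg (sb b)) (rep (Hs.getD b []) (tadd (sb b) x))) = x := by
    intro b hb x hx
    have h1 := List.all_eq_true.mp hd4 (Hs.getD b []) (hsub b hb)
    have h2 := List.all_eq_true.mp h1 (sb b) (hsbmem b)
    have h3 := List.all_eq_true.mp h2 x hx
    simp only [Bool.and_eq_true, decide_eq_true_eq, beq_iff_eq] at h3
    exact h3
  have hD5 : ∀ b, b < Hs.length → ∀ x ∈ names (Hs.getD b []), ∀ t : Fin 16,
      sgB (Hs.getD b []) (shiftT (Hs.getD b []) (tneg (sb b)) (Phis'.getD b [])) (rep (Hs.getD b []) (tadd (tneg (sb b)) x)) t =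
        sgB (Hs.getD b []) (Phis'.getD b []) x t := by
    intro b hb x hx t
    have hpair : (Hs.getD b [], Phis'.getD b []) ∈ pairs L sizes := by
      unfold pairs
      rw [List.mem_eraseDups]
      simp only [List.mem_flatMap, List.mem_map]
      exact ⟨_, hkey b hb, Phis'.getD b [], hD2 b hb, rfl⟩
    have h1 := List.all_eq_true.mp hd5 _ hpair
    have h2 := List.all_eq_true.mp h1 (sb b) (hsbmem b)
    have h3 := List.all_eq_true.mp h2 x hx
    have h4 := List.all_eq_true.mp h3 t (List.mem_finRange t)
    exact beq_iff_eq.mp h4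
  -- transfer along the shift bijection of the point set
  unfold Q
  refine hasPairs_transfer (pts ⟨iota, Hs, Phis'⟩).toFinset (pts ⟨iota, Hs, Phis⟩).toFinset
    (sg ⟨iota, Hs, Phis'⟩) (sg ⟨iota, Hs, Phis⟩)
    (fun p => (p.1, rep (Hs.getD p.1 []) (tadd (tneg (sb p.1)) p.2)))
    (fun p => (p.1, rep (Hs.getD p.1 []) (tadd (sb p.1) p.2))) ?_ ?_ hQ'
  · intro p hp
    have hp' := (mem_pts _ _).mp (List.mem_toFinset.mp hp)
    obtain ⟨hb, hx⟩ := hp'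
    obtain ⟨h1, h2⟩ := hD4 p.1 hb p.2 hx
    refine ⟨List.mem_toFinset.mpr ((mem_pts _ _).mpr ⟨hb, h1⟩), ?_⟩
    show (p.1, rep (Hs.getD p.1 []) (tadd (tneg (sb p.1)) (rep (Hs.getD p.1 []) (tadd (sb p.1) p.2)))) = p
    rw [h2]
  · intro a ha t
    have ha' := (mem_pts _ _).mp (List.mem_toFinset.mp ha)
    obtain ⟨hb, hx⟩ := ha'
    show sgB (Hs.getD a.1 []) (Phis.getD a.1 []) (rep (Hs.getD a.1 []) (tadd (tneg (sb a.1)) a.2)) t =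
      sgB (Hs.getD a.1 []) (Phis'.getD a.1 []) a.2 t
    rw [hback a.1 hb]
    exact hD5 a.1 hb a.2 hx t


end HodgeRepro0.P6NonSimple2Power
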